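import Summits.ResolutionOfSingularities.ResolutionOfSingularities.Theorems.PurelyInseparableDim4PureLeafUnitAtMostOneOdd
import HarnessLib
import HarnessLib.Audit.Tags

/-!
# Purely inseparable fourfolds — UNIFORM THEOREM (`a₀ = 1`, TWO odd partners): every unit leaf `x₀·x₁^{m₁}·x₂^{2b}·x₃^{m₃}·(1+x₀)` (`m₁, m₃` odd) is an A-WIN of the plain game over `𝔽₂` ‖ K
# (cell res-dim4-pi; brick (δ) «unit leaves x^a(1+x_j)», UNIFORM family «a₀ = 1, two odd partners, even third») [OURS · counted 0 · a theorem about OUR coordinate-centre frame v4, not about resolution]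

Width seat `res-dim4-p-10` (g6).  Sequel of `…PureLeafUnitOddPair` / `…OddThree` / `…OddAll` / `…AtMostOneOdd`.  The census
leaves 1123 1132 1213 1231 1312 1321 1233 1323 1332 (plain A-wins by certificate only, `…PureLeafUnitPlainOdd1B/1C/1D/1E`) are the
smallest members of ONE every-size family: `a₀ = 1`, exactly two partner exponents odd, the third even (any size, `0` allowed).
A's rule, read off the 1123 certificate (`lean-g5/py/rows_1123_plain.json`, first move `{x₁, x₃}`): **PAIR THE TWO ODD PARTNERS
FIRST.**  At `P = x₀x₁^{m₁}·S²·x₃^{m₃}(1+x₀)` (`S²` the even dress on `x₂`; `x₀(1+x₀)` is invariant under `x₀ ↦ x₀ + 1`, so B's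
`b₀` is idle) the centre `{x₁, x₃}` is permissible (`m₁ + m₃ ≥ 2`) and, with `M := m₁ + m₃ − 2` (even):

* chart `x₃` (`b₃ = 0`): `x₀x₁^{m₁}S′²x₃^{M}(1+x₀)` = the `a₀ = 1` ONE-odd-partner shape `A_{m₁}` with the even dress `S′²·x₃^M`
  (if `b₁ = 0`; `stateWins_unitLeaf_oneOdd_dressed`, p727028) or, after the cleaning, `G̃_{m₁}·S′²x₃^M` (if `b₁ = 1`; `stateWins_G`,
  p727909) — `step_F_pair13_three`;
* chart `x₁` (`b₁ = 0`): the same two shapes with partner `x₃` and dress `x₁^M·S′²` — `step_F_pair13_one`; won by the partner-`x₃`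
  transports `stateWins_A_partner3` / `stateWins_G_partner3` (renaming `x₁ ↔ x₃`, `PureLeafGlobalWin.stateWins_rename`,
  `rename_prod₄`).

Hence **`stateWins_P13`** (the dressed family) and the leaf forms **`stateWins_unitLeaf_one_twoOdd`** (odd partners `x₁, x₃`),
**`stateWins_unitLeaf_one_twoOdd_even`** (the even partner anywhere) and the `a₀ = 1` CAPSTONE **`stateWins_unitLeaf_one_of_not_all_odd`**:
a unit leaf `x^a(1+x₀)` with `a₀ = 1` is a plain A-win over `𝔽₂` unless ALL THREE partner exponents are odd (0/1 odd partner: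
`stateWins_unitLeaf_of_oddPartners_le_one₀`).  Inside the census `{1,2,3}⁴` the excluded `a₀ = 1` leaves are exactly 1111 (an A-win by
certificate, `UnitDivergence.unitLeafRow18`) and the seven `a₀ = 1` members 1113 1131 1133 1311 1313 1331 1333 of `UnitLeafPlain.plainOpen23`.
(For `a₀ = 3` the pair-first rule is NOT available: `x₀ ∉ {x₁, x₃}`, so B may translate `x₀³(1+x₀)` into `x₀(1+x₀)³` — 3123 is open.)

Riders: `𝔽₂`-rational replies; the PLAIN coordinate game of OUR frame v4 (`StateWins 2`), not MODE 1h, not CJS; nothing here proves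
F4-C(2,2), `Terminates1h 2 2` or resolution of singularities in dimension ≥ 4 / characteristic `p`; counted 0; AI kernel work, weaker
than expert review. bears_on: LADDER-RESOLUTION:D157-DOOR2 (res-dim4-pi · brick (δ) · unit-leaf row, uniform theorem).
Supports stmt-ResolutionOfSingularities-16155 (helper).
-/

set_option linter.dupNamespace false

open MvPolynomial Finset

open scoped BigOperators

noncomputable section

namespace Summit.ResolutionOfSingularities.ResolutionOfSingularities.Theorems.PIDim4

namespace PureLeafNF

open Literature.AlgebraicGeometry.Resolution
open Literature.AlgebraicGeometry.Resolution.Hauser2010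
open CentreBlowup PthPowerFactor

/-! ## 1. Renaming product states; the partner-`x₃` forms of the two `a₀ = 1` families -/

/-- Renaming a normal-form product permutes the exponent vectors. [folklore] -/
theorem rename_prod₄ (e : Equiv.Perm (Fin 4)) (a d : Fin 4 → ℕ) :
    rename e (∏ l, X l ^ a l * (1 + X l) ^ d l : MvPolynomial (Fin 4) (ZMod 2)) =
      ∏ l, X l ^ a (e.symm l) * (1 + X l) ^ d (e.symm l) := by
  rw [map_prod]
  simp only [map_mul, map_pow, map_add, map_one, rename_X]
  exact Fintype.prod_equiv e _ _ (fun l => by simp)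

/-- **`A_m` with partner `x₃`**: `x₀·x₁^{g₁}(1+x₁)^{e₁}·x₂^{g₂}(1+x₂)^{e₂}·x₃^m·(1+x₀)` wins (`m` odd, even dress on `x₁, x₂`),
every booking — `stateWins_unitLeaf_oneOdd_dressed` transported along `x₁ ↔ x₃`. [OURS · counted 0] [folklore] -/
theorem stateWins_A_partner3 (m g1 e1 g2 e2 : ℕ) (hm : m % 2 = 1) (hg1 : g1 % 2 = 0) (he1 : e1 % 2 = 0)
    (hg2 : g2 % 2 = 0) (he2 : e2 % 2 = 0) (r : Fin 4 →₀ ℕ) (exc : Finset (Fin 4)) :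
    StateWins 2 (⟨(∏ l, X l ^ (![1, g1, g2, m] : Fin 4 → ℕ) l * (1 + X l) ^ (![1, e1, e2, 0] : Fin 4 → ℕ) l : MvPolynomial (Fin 4) (ZMod 2)), r, exc⟩ : State (ZMod 2)) := by
  have h' := stateWins_unitLeaf_oneOdd_dressed m g2 g1 e2 e1 hm hg2 hg1 he2 he1 r exc
  have hren := WinCertF.stateWins_rebook (PureLeafGlobalWin.stateWins_rename (Equiv.swap 1 3) 2 h') r exc
  have hF : (State.rename (Equiv.swap 1 3) (⟨(∏ l, X l ^ (![1, m, g2, g1] : Fin 4 → ℕ) l * (1 + X l) ^ (![1, 0, e2, e1] : Fin 4 → ℕ) l : MvPolynomial (Fin 4) (ZMod 2)), r, exc⟩ : State (ZMod 2))).F =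
      (∏ l, X l ^ (![1, g1, g2, m] : Fin 4 → ℕ) l * (1 + X l) ^ (![1, e1, e2, 0] : Fin 4 → ℕ) l : MvPolynomial (Fin 4) (ZMod 2)) := by
    show rename (Equiv.swap 1 3) (∏ l, X l ^ (![1, m, g2, g1] : Fin 4 → ℕ) l * (1 + X l) ^ (![1, 0, e2, e1] : Fin 4 → ℕ) l : MvPolynomial (Fin 4) (ZMod 2)) = _
    rw [rename_prod₄]
    refine Finset.prod_congr rfl fun l _ => ?_
    fin_cases l <;> simp [Equiv.swap_apply_of_ne_of_ne]
  rw [hF] at hren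
  exact hren

/-- **`G̃_m·S²` with partner `x₃`**: `x₁^{g₁}(1+x₁)^{e₁}x₂^{g₂}(1+x₂)^{e₂}·(1+x₃)^n·(x₀ + x₀x₃ + x₀²x₃)` wins (`n` even, even dress on
`x₁, x₂`), every booking — `stateWins_G` transported along `x₁ ↔ x₃`. [OURS · counted 0] [folklore] -/
theorem stateWins_G_partner3 (n g1 e1 g2 e2 : ℕ) (hn : n % 2 = 0) (hg1 : g1 % 2 = 0) (he1 : e1 % 2 = 0)
    (hg2 : g2 % 2 = 0) (he2 : e2 % 2 = 0) (r : Fin 4 →₀ ℕ) (exc : Finset (Fin 4)) :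
    StateWins 2 (⟨((∏ l, X l ^ (![1, g1, g2, 0] : Fin 4 → ℕ) l * (1 + X l) ^ (![0, e1, e2, (n + 1)] : Fin 4 → ℕ) l : MvPolynomial (Fin 4) (ZMod 2)) + (∏ l, X l ^ (![2, g1, g2, 1] : Fin 4 → ℕ) l * (1 + X l) ^ (![0, e1, e2, n] : Fin 4 → ℕ) l : MvPolynomial (Fin 4) (ZMod 2))), r, exc⟩ : State (ZMod 2)) := by
  have h' := stateWins_G _ n g2 g1 e2 e1 hn hg2 hg1 he2 he1 le_rfl r exc
  have hren := WinCertF.stateWins_rebook (PureLeafGlobalWin.stateWins_rename (Equiv.swap 1 3) 2 h') r exc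
  have hF : (State.rename (Equiv.swap 1 3) (⟨((∏ l, X l ^ (![1, 0, g2, g1] : Fin 4 → ℕ) l * (1 + X l) ^ (![0, (n + 1), e2, e1] : Fin 4 → ℕ) l : MvPolynomial (Fin 4) (ZMod 2)) + (∏ l, X l ^ (![2, 1, g2, g1] : Fin 4 → ℕ) l * (1 + X l) ^ (![0, n, e2, e1] : Fin 4 → ℕ) l : MvPolynomial (Fin 4) (ZMod 2))), r, exc⟩ : State (ZMod 2))).F =
      ((∏ l, X l ^ (![1, g1, g2, 0] : Fin 4 → ℕ) l * (1 + X l) ^ (![0, e1, e2, (n + 1)] : Fin 4 → ℕ) l : MvPolynomial (Fin 4) (ZMod 2)) + (∏ l, X l ^ (![2, g1, g2, 1] : Fin 4 → ℕ) l * (1 + X l) ^ (![0, e1, e2, n] : Fin 4 → ℕ) l : MvPolynomial (Fin 4) (ZMod 2))) := by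
    show rename (Equiv.swap 1 3) ((∏ l, X l ^ (![1, 0, g2, g1] : Fin 4 → ℕ) l * (1 + X l) ^ (![0, (n + 1), e2, e1] : Fin 4 → ℕ) l : MvPolynomial (Fin 4) (ZMod 2)) + (∏ l, X l ^ (![2, 1, g2, g1] : Fin 4 → ℕ) l * (1 + X l) ^ (![0, n, e2, e1] : Fin 4 → ℕ) l : MvPolynomial (Fin 4) (ZMod 2))) = _
    rw [map_add, rename_prod₄, rename_prod₄]
    have e₁ : (∏ l, X l ^ (![1, 0, g2, g1] : Fin 4 → ℕ) ((Equiv.swap (1 : Fin 4) 3).symm l) * (1 + X l) ^ (![0, (n + 1), e2, e1] : Fin 4 → ℕ) ((Equiv.swap (1 : Fin 4) 3).symm l) : MvPolynomial (Fin 4) (ZMod 2)) =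
        (∏ l, X l ^ (![1, g1, g2, 0] : Fin 4 → ℕ) l * (1 + X l) ^ (![0, e1, e2, (n + 1)] : Fin 4 → ℕ) l : MvPolynomial (Fin 4) (ZMod 2)) :=
      Finset.prod_congr rfl fun l _ => by fin_cases l <;> simp [Equiv.swap_apply_of_ne_of_ne]
    have e₂ : (∏ l, X l ^ (![2, 1, g2, g1] : Fin 4 → ℕ) ((Equiv.swap (1 : Fin 4) 3).symm l) * (1 + X l) ^ (![0, n, e2, e1] : Fin 4 → ℕ) ((Equiv.swap (1 : Fin 4) 3).symm l) : MvPolynomial (Fin 4) (ZMod 2)) =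
        (∏ l, X l ^ (![2, g1, g2, 1] : Fin 4 → ℕ) l * (1 + X l) ^ (![0, e1, e2, n] : Fin 4 → ℕ) l : MvPolynomial (Fin 4) (ZMod 2)) :=
      Finset.prod_congr rfl fun l _ => by fin_cases l <;> simp [Equiv.swap_apply_of_ne_of_ne]
    rw [e₁, e₂]
  rw [hF] at hren
  exact hren

/-! ## 2. The pair centre `{x₁, x₃}` on the leaf shape `P = x₀x₁^{n₁+1}·S²·x₃^{n₃+1}(1+x₀)` (`n₁, n₃` even) -/

/-- `P = (x₁^{m₁} x₃^{m₃}) · D`, `D = x₀(1+x₀)·S²` the part supported off `{x₁, x₃}`. [folklore] -/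
theorem P13_eq_mul (m1 g2 m3 e2 : ℕ) :
    (∏ l, X l ^ (![1, m1, g2, m3] : Fin 4 → ℕ) l * (1 + X l) ^ (![1, 0, e2, 0] : Fin 4 → ℕ) l : MvPolynomial (Fin 4) (ZMod 2)) =
      (X 1 ^ m1 * X 3 ^ m3) * (∏ l, X l ^ (![1, 0, g2, 0] : Fin 4 → ℕ) l * (1 + X l) ^ (![1, 0, e2, 0] : Fin 4 → ℕ) l : MvPolynomial (Fin 4) (ZMod 2)) := by
  rw [Fin.prod_univ_four, Fin.prod_univ_four]
  simp
  ring

/-- `D` is supported off `{x₁, x₃}`. [folklore] -/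
theorem support_D13_off (g2 e2 : ℕ) :
    ∀ d ∈ (∏ l, X l ^ (![1, 0, g2, 0] : Fin 4 → ℕ) l * (1 + X l) ^ (![1, 0, e2, 0] : Fin 4 → ℕ) l : MvPolynomial (Fin 4) (ZMod 2)).support, ∀ i ∈ ({1, 3} : Finset (Fin 4)), d i = 0 := by
  have h := support_cofactor_off (K := ZMod 2) (![1, 0, g2, 0] : Fin 4 → ℕ) (![1, 0, e2, 0] : Fin 4 → ℕ) (j := 1) (k := 3)
    (by simp) (by simp)
  have hupd : Function.update (Function.update (![1, 0, g2, 0] : Fin 4 → ℕ) 1 0) 3 0 = ![1, 0, g2, 0] := by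
    funext l; fin_cases l <;> simp
  rw [hupd] at h
  exact h

/-- `chartTransform 2 {x₁,x₃} x₁ (x₁^{n₁+1} x₃^{n₃+1}) = x₁^{n₁+n₃} x₃^{n₃+1}`. [folklore] -/
theorem chartTransform_pair13_one_pow (n1 n3 : ℕ) :
    chartTransform 2 ({1, 3} : Finset (Fin 4)) 1 (X 1 ^ (n1 + 1) * X 3 ^ (n3 + 1) : MvPolynomial (Fin 4) (ZMod 2)) =
      X 1 ^ (n1 + n3) * X 3 ^ (n3 + 1) := by
  have h1 : (X 1 ^ (n1 + 1) * X 3 ^ (n3 + 1) : MvPolynomial (Fin 4) (ZMod 2)) =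
      monomial (Finsupp.single 1 (n1 + 1) + Finsupp.single 3 (n3 + 1)) 1 := by
    rw [X_pow_eq_monomial, X_pow_eq_monomial, monomial_mul, one_mul]
  have h2 : (X 1 ^ (n1 + n3) * X 3 ^ (n3 + 1) : MvPolynomial (Fin 4) (ZMod 2)) =
      monomial (Finsupp.single 1 (n1 + n3) + Finsupp.single 3 (n3 + 1)) 1 := by
    rw [X_pow_eq_monomial, X_pow_eq_monomial, monomial_mul, one_mul]
  have hexp : chartExponent 2 ({1, 3} : Finset (Fin 4)) 1 (Finsupp.single 1 (n1 + 1) + Finsupp.single 3 (n3 + 1)) =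
      Finsupp.single 1 (n1 + n3) + Finsupp.single 3 (n3 + 1) := by
    rw [chartExponent_eq_iff, degIn_pair (show (1 : Fin 4) ≠ 3 by decide)]
    refine ⟨?_, fun i hi => ?_⟩
    · simp; omega
    · simp [Finsupp.single_apply, Ne.symm hi]
  rw [h1, h2, chartTransform_monomial, hexp]

/-- `chartTransform 2 {x₁,x₃} x₃ (x₁^{n₁+1} x₃^{n₃+1}) = x₁^{n₁+1} x₃^{n₁+n₃}`. [folklore] -/
theorem chartTransform_pair13_three_pow (n1 n3 : ℕ) :
    chartTransform 2 ({1, 3} : Finset (Fin 4)) 3 (X 1 ^ (n1 + 1) * X 3 ^ (n3 + 1) : MvPolynomial (Fin 4) (ZMod 2)) =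
      X 1 ^ (n1 + 1) * X 3 ^ (n1 + n3) := by
  have h1 : (X 1 ^ (n1 + 1) * X 3 ^ (n3 + 1) : MvPolynomial (Fin 4) (ZMod 2)) =
      monomial (Finsupp.single 1 (n1 + 1) + Finsupp.single 3 (n3 + 1)) 1 := by
    rw [X_pow_eq_monomial, X_pow_eq_monomial, monomial_mul, one_mul]
  have h2 : (X 1 ^ (n1 + 1) * X 3 ^ (n1 + n3) : MvPolynomial (Fin 4) (ZMod 2)) =
      monomial (Finsupp.single 1 (n1 + 1) + Finsupp.single 3 (n1 + n3)) 1 := by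
    rw [X_pow_eq_monomial, X_pow_eq_monomial, monomial_mul, one_mul]
  have hexp : chartExponent 2 ({1, 3} : Finset (Fin 4)) 3 (Finsupp.single 1 (n1 + 1) + Finsupp.single 3 (n3 + 1)) =
      Finsupp.single 1 (n1 + 1) + Finsupp.single 3 (n1 + n3) := by
    rw [chartExponent_eq_iff, degIn_pair (show (1 : Fin 4) ≠ 3 by decide)]
    refine ⟨?_, fun i hi => ?_⟩
    · simp; omega
    · simp [Finsupp.single_apply, Ne.symm hi]
  rw [h1, h2, chartTransform_monomial, hexp]

/-- **Chart `x₁` of `{x₁, x₃}` on `P`**: `x₀x₁^{n₁+n₃}·S²·x₃^{n₃+1}(1+x₀)`. [folklore] -/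
theorem chartTransform_pair13_one_P (n1 g2 n3 e2 : ℕ) :
    chartTransform 2 ({1, 3} : Finset (Fin 4)) 1 (∏ l, X l ^ (![1, (n1 + 1), g2, (n3 + 1)] : Fin 4 → ℕ) l * (1 + X l) ^ (![1, 0, e2, 0] : Fin 4 → ℕ) l : MvPolynomial (Fin 4) (ZMod 2)) =
      (∏ l, X l ^ (![1, (n1 + n3), g2, (n3 + 1)] : Fin 4 → ℕ) l * (1 + X l) ^ (![1, 0, e2, 0] : Fin 4 → ℕ) l : MvPolynomial (Fin 4) (ZMod 2)) := by
  rw [P13_eq_mul, MohAlong.chartTransform_mul_offS (by simp) 2 _ _ (support_D13_off g2 e2), chartTransform_pair13_one_pow,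
    ← P13_eq_mul]

/-- **Chart `x₃` of `{x₁, x₃}` on `P`**: `x₀x₁^{n₁+1}·S²·x₃^{n₁+n₃}(1+x₀)`. [folklore] -/
theorem chartTransform_pair13_three_P (n1 g2 n3 e2 : ℕ) :
    chartTransform 2 ({1, 3} : Finset (Fin 4)) 3 (∏ l, X l ^ (![1, (n1 + 1), g2, (n3 + 1)] : Fin 4 → ℕ) l * (1 + X l) ^ (![1, 0, e2, 0] : Fin 4 → ℕ) l : MvPolynomial (Fin 4) (ZMod 2)) =
      (∏ l, X l ^ (![1, (n1 + 1), g2, (n1 + n3)] : Fin 4 → ℕ) l * (1 + X l) ^ (![1, 0, e2, 0] : Fin 4 → ℕ) l : MvPolynomial (Fin 4) (ZMod 2)) := by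
  rw [P13_eq_mul, MohAlong.chartTransform_mul_offS (by simp) 2 _ _ (support_D13_off g2 e2), chartTransform_pair13_three_pow,
    ← P13_eq_mul]

/-- `x₀(1+x₀)·T = x₀·T + x₀²·T` for the product `T = x₁^{a₁}(1+x₁)^{d₁}x₂^{a₂}(1+x₂)^{d₂}x₃^{a₃}(1+x₃)^{d₃}`. [folklore] -/
theorem split_unit0 (a1 a2 a3 d1 d2 d3 : ℕ) :
    (∏ l, X l ^ (![1, a1, a2, a3] : Fin 4 → ℕ) l * (1 + X l) ^ (![1, d1, d2, d3] : Fin 4 → ℕ) l : MvPolynomial (Fin 4) (ZMod 2)) = (∏ l, X l ^ (![1, a1, a2, a3] : Fin 4 → ℕ) l * (1 + X l) ^ (![0, d1, d2, d3] : Fin 4 → ℕ) l : MvPolynomial (Fin 4) (ZMod 2)) + (∏ l, X l ^ (![2, a1, a2, a3] : Fin 4 → ℕ) l * (1 + X l) ^ (![0, d1, d2, d3] : Fin 4 → ℕ) l : MvPolynomial (Fin 4) (ZMod 2)) := by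
  have hI := prod_update_e_succ (![1, a1, a2, a3] : Fin 4 → ℕ) (![0, d1, d2, d3] : Fin 4 → ℕ) 0
  have h1 : Function.update (![0, d1, d2, d3] : Fin 4 → ℕ) 0 ((![0, d1, d2, d3] : Fin 4 → ℕ) 0 + 1) = (![1, d1, d2, d3] : Fin 4 → ℕ) := by
    funext l; fin_cases l <;> simp
  have h2 : Function.update (![1, a1, a2, a3] : Fin 4 → ℕ) 0 ((![1, a1, a2, a3] : Fin 4 → ℕ) 0 + 1) = (![2, a1, a2, a3] : Fin 4 → ℕ) := by
    funext l; fin_cases l <;> simp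
  rw [h1, h2] at hI
  exact hI

/-- `x₀²x₂^{p}(1+x₂)^{r}x₃^{M}·(1+x₁)^{n₁+1}` (`p r M n₁` even) cleans to `x₀²x₁(1+x₁)^{n₁}·x₂^{p}(1+x₂)^{r}x₃^{M}`. [folklore] -/
theorem clean_sq0_odd1 (n1 p r M : ℕ) (hn1 : n1 % 2 = 0) (hp : p % 2 = 0) (hr : r % 2 = 0) (hM : M % 2 = 0) :
    deletePthPowers 2 (∏ l, X l ^ (![2, 0, p, M] : Fin 4 → ℕ) l * (1 + X l) ^ (![0, (n1 + 1), r, 0] : Fin 4 → ℕ) l : MvPolynomial (Fin 4) (ZMod 2)) = (∏ l, X l ^ (![2, 1, p, M] : Fin 4 → ℕ) l * (1 + X l) ^ (![0, n1, r, 0] : Fin 4 → ℕ) l : MvPolynomial (Fin 4) (ZMod 2)) := by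
  have ha : ∀ l, (![2, 0, p, M] : Fin 4 → ℕ) l % 2 = 0 := by
    intro l; fin_cases l <;> simp_all
  have he : ∀ l, l ≠ (1 : Fin 4) → (![0, (n1 + 1), r, 0] : Fin 4 → ℕ) l % 2 = 0 := by
    intro l hl; fin_cases l <;> simp_all
  rw [clean_even_oddAt _ _ 1 ha he (by simp; omega)]
  congr 1; funext l; fin_cases l <;> simp

/-- `x₀²x₁^{M}x₂^{p}(1+x₂)^{r}·(1+x₃)^{n₃+1}` (`p r M n₃` even) cleans to `x₀²x₁^{M}x₂^{p}(1+x₂)^{r}·x₃(1+x₃)^{n₃}`. [folklore] -/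
theorem clean_sq0_odd3 (n3 p r M : ℕ) (hn3 : n3 % 2 = 0) (hp : p % 2 = 0) (hr : r % 2 = 0) (hM : M % 2 = 0) :
    deletePthPowers 2 (∏ l, X l ^ (![2, M, p, 0] : Fin 4 → ℕ) l * (1 + X l) ^ (![0, 0, r, (n3 + 1)] : Fin 4 → ℕ) l : MvPolynomial (Fin 4) (ZMod 2)) = (∏ l, X l ^ (![2, M, p, 1] : Fin 4 → ℕ) l * (1 + X l) ^ (![0, 0, r, n3] : Fin 4 → ℕ) l : MvPolynomial (Fin 4) (ZMod 2)) := by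
  have ha : ∀ l, (![2, M, p, 0] : Fin 4 → ℕ) l % 2 = 0 := by
    intro l; fin_cases l <;> simp_all
  have he : ∀ l, l ≠ (3 : Fin 4) → (![0, 0, r, (n3 + 1)] : Fin 4 → ℕ) l % 2 = 0 := by
    intro l hl; fin_cases l <;> simp_all
  rw [clean_even_oddAt _ _ 3 ha he (by simp; omega)]
  congr 1; funext l; fin_cases l <;> simp

/-- **The pair move `{x₁, x₃}` at `P`, chart `x₃`** (`b₃ = 0`): `A_{n₁+1}` with the dress `S′²·x₃^{n₁+n₃}` (if `b₁ = 0`) or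
`G̃_{n₁+1}` with that dress (if `b₁ = 1`). [folklore] -/
theorem step_F_pair13_three (n1 g2 n3 e2 : ℕ) (hn1 : n1 % 2 = 0) (hn3 : n3 % 2 = 0) (hg2 : g2 % 2 = 0) (he2 : e2 % 2 = 0)
    (b : Fin 4 → ZMod 2) (hb : b 3 = 0) (r : Fin 4 →₀ ℕ) (exc : Finset (Fin 4)) :
    ((step 2 ({1, 3} : Finset (Fin 4)) 3 b (⟨(∏ l, X l ^ (![1, (n1 + 1), g2, (n3 + 1)] : Fin 4 → ℕ) l * (1 + X l) ^ (![1, 0, e2, 0] : Fin 4 → ℕ) l : MvPolynomial (Fin 4) (ZMod 2)), r, exc⟩ : State (ZMod 2))).F =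
        (∏ l, X l ^ (![1, (n1 + 1), (if b 2 = 0 then g2 else e2), (n1 + n3)] : Fin 4 → ℕ) l * (1 + X l) ^ (![1, 0, (if b 2 = 0 then e2 else g2), 0] : Fin 4 → ℕ) l : MvPolynomial (Fin 4) (ZMod 2)) ∧ b 1 = 0) ∨
    ((step 2 ({1, 3} : Finset (Fin 4)) 3 b (⟨(∏ l, X l ^ (![1, (n1 + 1), g2, (n3 + 1)] : Fin 4 → ℕ) l * (1 + X l) ^ (![1, 0, e2, 0] : Fin 4 → ℕ) l : MvPolynomial (Fin 4) (ZMod 2)), r, exc⟩ : State (ZMod 2))).F =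
        ((∏ l, X l ^ (![1, 0, (if b 2 = 0 then g2 else e2), (n1 + n3)] : Fin 4 → ℕ) l * (1 + X l) ^ (![0, (n1 + 1), (if b 2 = 0 then e2 else g2), 0] : Fin 4 → ℕ) l : MvPolynomial (Fin 4) (ZMod 2)) + (∏ l, X l ^ (![2, 1, (if b 2 = 0 then g2 else e2), (n1 + n3)] : Fin 4 → ℕ) l * (1 + X l) ^ (![0, n1, (if b 2 = 0 then e2 else g2), 0] : Fin 4 → ℕ) l : MvPolynomial (Fin 4) (ZMod 2))) ∧ b 1 = 1) := by
  have hP : ∀ u : ℕ, u % 2 = 0 → ∀ v : ℕ, v % 2 = 0 → ∀ z : ZMod 2, (if z = 0 then u else v) % 2 = 0 := by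
    intro u hu v hv z; split_ifs <;> assumption
  have hp' := hP _ hg2 _ he2 (b 2); have hr' := hP _ he2 _ hg2 (b 2)
  have hM : (n1 + n3) % 2 = 0 := by omega
  change deletePthPowers 2 (PointBlowup.translate b (chartTransform 2 {1, 3} 3 (∏ l, X l ^ (![1, (n1 + 1), g2, (n3 + 1)] : Fin 4 → ℕ) l * (1 + X l) ^ (![1, 0, e2, 0] : Fin 4 → ℕ) l : MvPolynomial (Fin 4) (ZMod 2)))) = _ ∧ _ ∨
    deletePthPowers 2 (PointBlowup.translate b (chartTransform 2 {1, 3} 3 (∏ l, X l ^ (![1, (n1 + 1), g2, (n3 + 1)] : Fin 4 → ℕ) l * (1 + X l) ^ (![1, 0, e2, 0] : Fin 4 → ℕ) l : MvPolynomial (Fin 4) (ZMod 2)))) = _ ∧ _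
  rw [chartTransform_pair13_three_P, translate_prod_zmod2]
  rcases (by decide : ∀ z : ZMod 2, z = 0 ∨ z = 1) (b 1) with h1 | h1
  · left
    refine ⟨?_, h1⟩
    rw [show (∏ l, X l ^ (if b l = 0 then (![1, (n1 + 1), g2, (n1 + n3)] : Fin 4 → ℕ) l else (![1, 0, e2, 0] : Fin 4 → ℕ) l) *
        (1 + X l) ^ (if b l = 0 then (![1, 0, e2, 0] : Fin 4 → ℕ) l else (![1, (n1 + 1), g2, (n1 + n3)] : Fin 4 → ℕ) l) : MvPolynomial (Fin 4) (ZMod 2)) =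
        (∏ l, X l ^ (![1, (n1 + 1), (if b 2 = 0 then g2 else e2), (n1 + n3)] : Fin 4 → ℕ) l * (1 + X l) ^ (![1, 0, (if b 2 = 0 then e2 else g2), 0] : Fin 4 → ℕ) l : MvPolynomial (Fin 4) (ZMod 2)) from
      Finset.prod_congr rfl fun l _ => by fin_cases l <;> simp [h1, hb],
      deletePthPowers_prod_of_purelyOdd (![1, (n1 + 1), (if b 2 = 0 then g2 else e2), (n1 + n3)] : Fin 4 → ℕ) (![1, 0, (if b 2 = 0 then e2 else g2), 0] : Fin 4 → ℕ) (l := 1) (by simp; omega) (by simp)]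
  · right
    refine ⟨?_, h1⟩
    rw [show (∏ l, X l ^ (if b l = 0 then (![1, (n1 + 1), g2, (n1 + n3)] : Fin 4 → ℕ) l else (![1, 0, e2, 0] : Fin 4 → ℕ) l) *
        (1 + X l) ^ (if b l = 0 then (![1, 0, e2, 0] : Fin 4 → ℕ) l else (![1, (n1 + 1), g2, (n1 + n3)] : Fin 4 → ℕ) l) : MvPolynomial (Fin 4) (ZMod 2)) =
        (∏ l, X l ^ (![1, 0, (if b 2 = 0 then g2 else e2), (n1 + n3)] : Fin 4 → ℕ) l * (1 + X l) ^ (![1, (n1 + 1), (if b 2 = 0 then e2 else g2), 0] : Fin 4 → ℕ) l : MvPolynomial (Fin 4) (ZMod 2)) from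
      Finset.prod_congr rfl fun l _ => by fin_cases l <;> simp [h1, hb],
      split_unit0, deletePthPowers_add,
      deletePthPowers_prod_of_purelyOdd (![1, 0, (if b 2 = 0 then g2 else e2), (n1 + n3)] : Fin 4 → ℕ) (![0, (n1 + 1), (if b 2 = 0 then e2 else g2), 0] : Fin 4 → ℕ) (l := 0) (by simp) (by simp),
      clean_sq0_odd1 _ _ _ _ hn1 hp' hr' hM]

/-- **The pair move `{x₁, x₃}` at `P`, chart `x₁`** (`b₁ = 0`): the partner-`x₃` shapes `A_{n₃+1}` (if `b₃ = 0`) or `G̃_{n₃+1}`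
(if `b₃ = 1`) with the dress `x₁^{n₁+n₃}·S′²`. [folklore] -/
theorem step_F_pair13_one (n1 g2 n3 e2 : ℕ) (hn1 : n1 % 2 = 0) (hn3 : n3 % 2 = 0) (hg2 : g2 % 2 = 0) (he2 : e2 % 2 = 0)
    (b : Fin 4 → ZMod 2) (hb : b 1 = 0) (r : Fin 4 →₀ ℕ) (exc : Finset (Fin 4)) :
    ((step 2 ({1, 3} : Finset (Fin 4)) 1 b (⟨(∏ l, X l ^ (![1, (n1 + 1), g2, (n3 + 1)] : Fin 4 → ℕ) l * (1 + X l) ^ (![1, 0, e2, 0] : Fin 4 → ℕ) l : MvPolynomial (Fin 4) (ZMod 2)), r, exc⟩ : State (ZMod 2))).F =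
        (∏ l, X l ^ (![1, (n1 + n3), (if b 2 = 0 then g2 else e2), (n3 + 1)] : Fin 4 → ℕ) l * (1 + X l) ^ (![1, 0, (if b 2 = 0 then e2 else g2), 0] : Fin 4 → ℕ) l : MvPolynomial (Fin 4) (ZMod 2)) ∧ b 3 = 0) ∨
    ((step 2 ({1, 3} : Finset (Fin 4)) 1 b (⟨(∏ l, X l ^ (![1, (n1 + 1), g2, (n3 + 1)] : Fin 4 → ℕ) l * (1 + X l) ^ (![1, 0, e2, 0] : Fin 4 → ℕ) l : MvPolynomial (Fin 4) (ZMod 2)), r, exc⟩ : State (ZMod 2))).F =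
        ((∏ l, X l ^ (![1, (n1 + n3), (if b 2 = 0 then g2 else e2), 0] : Fin 4 → ℕ) l * (1 + X l) ^ (![0, 0, (if b 2 = 0 then e2 else g2), (n3 + 1)] : Fin 4 → ℕ) l : MvPolynomial (Fin 4) (ZMod 2)) + (∏ l, X l ^ (![2, (n1 + n3), (if b 2 = 0 then g2 else e2), 1] : Fin 4 → ℕ) l * (1 + X l) ^ (![0, 0, (if b 2 = 0 then e2 else g2), n3] : Fin 4 → ℕ) l : MvPolynomial (Fin 4) (ZMod 2))) ∧ b 3 = 1) := by
  have hP : ∀ u : ℕ, u % 2 = 0 → ∀ v : ℕ, v % 2 = 0 → ∀ z : ZMod 2, (if z = 0 then u else v) % 2 = 0 := by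
    intro u hu v hv z; split_ifs <;> assumption
  have hp' := hP _ hg2 _ he2 (b 2); have hr' := hP _ he2 _ hg2 (b 2)
  have hM : (n1 + n3) % 2 = 0 := by omega
  change deletePthPowers 2 (PointBlowup.translate b (chartTransform 2 {1, 3} 1 (∏ l, X l ^ (![1, (n1 + 1), g2, (n3 + 1)] : Fin 4 → ℕ) l * (1 + X l) ^ (![1, 0, e2, 0] : Fin 4 → ℕ) l : MvPolynomial (Fin 4) (ZMod 2)))) = _ ∧ _ ∨
    deletePthPowers 2 (PointBlowup.translate b (chartTransform 2 {1, 3} 1 (∏ l, X l ^ (![1, (n1 + 1), g2, (n3 + 1)] : Fin 4 → ℕ) l * (1 + X l) ^ (![1, 0, e2, 0] : Fin 4 → ℕ) l : MvPolynomial (Fin 4) (ZMod 2)))) = _ ∧ _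
  rw [chartTransform_pair13_one_P, translate_prod_zmod2]
  rcases (by decide : ∀ z : ZMod 2, z = 0 ∨ z = 1) (b 3) with h3 | h3
  · left
    refine ⟨?_, h3⟩
    rw [show (∏ l, X l ^ (if b l = 0 then (![1, (n1 + n3), g2, (n3 + 1)] : Fin 4 → ℕ) l else (![1, 0, e2, 0] : Fin 4 → ℕ) l) *
        (1 + X l) ^ (if b l = 0 then (![1, 0, e2, 0] : Fin 4 → ℕ) l else (![1, (n1 + n3), g2, (n3 + 1)] : Fin 4 → ℕ) l) : MvPolynomial (Fin 4) (ZMod 2)) =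
        (∏ l, X l ^ (![1, (n1 + n3), (if b 2 = 0 then g2 else e2), (n3 + 1)] : Fin 4 → ℕ) l * (1 + X l) ^ (![1, 0, (if b 2 = 0 then e2 else g2), 0] : Fin 4 → ℕ) l : MvPolynomial (Fin 4) (ZMod 2)) from
      Finset.prod_congr rfl fun l _ => by fin_cases l <;> simp [h3, hb],
      deletePthPowers_prod_of_purelyOdd (![1, (n1 + n3), (if b 2 = 0 then g2 else e2), (n3 + 1)] : Fin 4 → ℕ) (![1, 0, (if b 2 = 0 then e2 else g2), 0] : Fin 4 → ℕ) (l := 3) (by simp; omega) (by simp)]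
  · right
    refine ⟨?_, h3⟩
    rw [show (∏ l, X l ^ (if b l = 0 then (![1, (n1 + n3), g2, (n3 + 1)] : Fin 4 → ℕ) l else (![1, 0, e2, 0] : Fin 4 → ℕ) l) *
        (1 + X l) ^ (if b l = 0 then (![1, 0, e2, 0] : Fin 4 → ℕ) l else (![1, (n1 + n3), g2, (n3 + 1)] : Fin 4 → ℕ) l) : MvPolynomial (Fin 4) (ZMod 2)) =
        (∏ l, X l ^ (![1, (n1 + n3), (if b 2 = 0 then g2 else e2), 0] : Fin 4 → ℕ) l * (1 + X l) ^ (![1, 0, (if b 2 = 0 then e2 else g2), (n3 + 1)] : Fin 4 → ℕ) l : MvPolynomial (Fin 4) (ZMod 2)) from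
      Finset.prod_congr rfl fun l _ => by fin_cases l <;> simp [h3, hb],
      split_unit0, deletePthPowers_add,
      deletePthPowers_prod_of_purelyOdd (![1, (n1 + n3), (if b 2 = 0 then g2 else e2), 0] : Fin 4 → ℕ) (![0, 0, (if b 2 = 0 then e2 else g2), (n3 + 1)] : Fin 4 → ℕ) (l := 0) (by simp) (by simp),
      clean_sq0_odd3 _ _ _ _ hn3 hp' hr' hM]

/-! ## 3. The theorems -/

/-- **`P = x₀x₁^{n₁+1}·x₂^{g₂}(1+x₂)^{e₂}·x₃^{n₃+1}(1+x₀)` wins** (`n₁ n₃ g₂ e₂` even), every booking: the pair `{x₁, x₃}`.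
[OURS · counted 0] [folklore] -/
theorem stateWins_P13 (n1 g2 n3 e2 : ℕ) (hn1 : n1 % 2 = 0) (hn3 : n3 % 2 = 0) (hg2 : g2 % 2 = 0) (he2 : e2 % 2 = 0)
    (r : Fin 4 →₀ ℕ) (exc : Finset (Fin 4)) :
    StateWins 2 (⟨(∏ l, X l ^ (![1, (n1 + 1), g2, (n3 + 1)] : Fin 4 → ℕ) l * (1 + X l) ^ (![1, 0, e2, 0] : Fin 4 → ℕ) l : MvPolynomial (Fin 4) (ZMod 2)), r, exc⟩ : State (ZMod 2)) := by
  have hstate : ∀ t : State (ZMod 2), t = ⟨t.F, t.r, t.exc⟩ := fun t => rfl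
  have hP : ∀ u : ℕ, u % 2 = 0 → ∀ v : ℕ, v % 2 = 0 → ∀ z : ZMod 2, (if z = 0 then u else v) % 2 = 0 := by
    intro u hu v hv z; split_ifs <;> assumption
  have hM : (n1 + n3) % 2 = 0 := by omega
  unfold StateWins
  refine Game.Wins.move (m := ({1, 3} : Finset (Fin 4))) ⟨⟨1, by simp⟩, ?_⟩ ?_
  · show (2 : ℕ∞) ≤ ordAlong {1, 3} (∏ l, X l ^ (![1, (n1 + 1), g2, (n3 + 1)] : Fin 4 → ℕ) l * (1 + X l) ^ (![1, 0, e2, 0] : Fin 4 → ℕ) l : MvPolynomial (Fin 4) (ZMod 2))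
    rw [ordAlong_prod, degIn_pair (show (1 : Fin 4) ≠ 3 by decide)]
    simpa using (show (2 : ℕ∞) ≤ ((n1 + 1 + (n3 + 1) : ℕ) : ℕ∞) by exact_mod_cast (by omega : 2 ≤ n1 + 1 + (n3 + 1)))
  rintro s' ⟨j', b, hj', hbj, -, -, rfl⟩
  rw [hstate (step 2 _ _ b _)]
  simp only [Finset.mem_insert, Finset.mem_singleton] at hj'
  rcases hj' with rfl | rfl
  · rcases step_F_pair13_one n1 g2 n3 e2 hn1 hn3 hg2 he2 b hbj r exc with ⟨hF, -⟩ | ⟨hF, -⟩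
    · rw [hF]
      exact stateWins_A_partner3 (n3 + 1) (n1 + n3) 0 _ _ (by omega) hM (by decide) (hP _ hg2 _ he2 _) (hP _ he2 _ hg2 _) _ _
    · rw [hF]
      exact stateWins_G_partner3 n3 (n1 + n3) 0 _ _ hn3 hM (by decide) (hP _ hg2 _ he2 _) (hP _ he2 _ hg2 _) _ _
  · rcases step_F_pair13_three n1 g2 n3 e2 hn1 hn3 hg2 he2 b hbj r exc with ⟨hF, -⟩ | ⟨hF, -⟩
    · rw [hF]
      exact stateWins_unitLeaf_oneOdd_dressed (n1 + 1) _ (n1 + n3) _ 0 (by omega) (hP _ hg2 _ he2 _) hM (hP _ he2 _ hg2 _) (by decide) _ _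
    · rw [hF]
      exact stateWins_G _ n1 _ (n1 + n3) _ 0 hn1 (hP _ hg2 _ he2 _) hM (hP _ he2 _ hg2 _) (by decide) le_rfl _ _

/-- **UNIFORM THEOREM (unit leaves, `a₀ = 1`, odd partners `x₁` and `x₃`, even `a₂`).** For every `a` with `a₀ = 1`, `a₁, a₃` odd and
`a₂` even, and every booking, the unit leaf `x^a·(1+x₀)` is an A-WIN of the plain game over `𝔽₂`. [OURS · counted 0 · ‖ K] [folklore] -/
theorem stateWins_unitLeaf_one_twoOdd (a : Fin 4 → ℕ) (h0 : a 0 = 1) (h1 : a 1 % 2 = 1) (h2 : a 2 % 2 = 0) (h3 : a 3 % 2 = 1)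
    (r : Fin 4 →₀ ℕ) (exc : Finset (Fin 4)) :
    StateWins 2 (⟨monomial (Finsupp.equivFunOnFinite.symm a) 1 * (1 + X 0), r, exc⟩ : State (ZMod 2)) := by
  have ha : a = (![1, (a 1 - 1 + 1), a 2, (a 3 - 1 + 1)] : Fin 4 → ℕ) := by
    funext l
    fin_cases l
    · simp [h0]
    · simp; omega
    · simp
    · simp; omega
  have hF : (monomial (Finsupp.equivFunOnFinite.symm a) 1 * (1 + X 0) : MvPolynomial (Fin 4) (ZMod 2)) =
      (∏ l, X l ^ (![1, ((a 1 - 1) + 1), (a 2), ((a 3 - 1) + 1)] : Fin 4 → ℕ) l * (1 + X l) ^ (![1, 0, 0, 0] : Fin 4 → ℕ) l : MvPolynomial (Fin 4) (ZMod 2)) := by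
    rw [prod_eq_monomial_mul, Fin.prod_univ_four, ← ha]
    simp
  rw [hF]
  exact stateWins_P13 (a 1 - 1) (a 2) (a 3 - 1) 0 (by omega) (by omega) h2 (by decide) r exc

/-- … with the EVEN partner anywhere: `a₀ = 1`, `a_k` even for one `k ≠ 0`, the other two partner exponents odd. [OURS · counted 0 · ‖ K]
[folklore] -/
theorem stateWins_unitLeaf_one_twoOdd_even (k : Fin 4) (hk : k ≠ 0) (a : Fin 4 → ℕ) (h0 : a 0 = 1) (hk0 : a k % 2 = 0)
    (hodd : ∀ i, i ≠ 0 → i ≠ k → a i % 2 = 1) (r : Fin 4 →₀ ℕ) (exc : Finset (Fin 4)) :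
    StateWins 2 (⟨monomial (Finsupp.equivFunOnFinite.symm a) 1 * (1 + X 0), r, exc⟩ : State (ZMod 2)) := by
  -- transport along a renaming fixing `x₀`
  have key : ∀ (e : Equiv.Perm (Fin 4)), e 0 = 0 → a (e 1) % 2 = 1 → a (e 2) % 2 = 0 → a (e 3) % 2 = 1 →
      StateWins 2 (⟨monomial (Finsupp.equivFunOnFinite.symm a) 1 * (1 + X 0), r, exc⟩ : State (ZMod 2)) := by
    intro e he0 he1 he2 he3
    have h' := stateWins_unitLeaf_one_twoOdd (fun i => a (e i)) (by simp [he0, h0]) he1 he2 he3 r exc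
    have hren := WinCertF.stateWins_rebook (PureLeafGlobalWin.stateWins_rename e 2 h') r exc
    have hd : Finsupp.mapDomain (⇑e) (Finsupp.equivFunOnFinite.symm fun i => a (e i)) = Finsupp.equivFunOnFinite.symm a := by
      ext i
      rw [Finsupp.mapDomain_equiv_apply]
      simp
    have hF : (State.rename e (⟨monomial (Finsupp.equivFunOnFinite.symm fun i => a (e i)) 1 * (1 + X 0), r, exc⟩ :
        State (ZMod 2))).F = monomial (Finsupp.equivFunOnFinite.symm a) 1 * (1 + X 0) := by
      show rename e (monomial (Finsupp.equivFunOnFinite.symm fun i => a (e i)) 1 * (1 + X 0) : MvPolynomial (Fin 4) (ZMod 2)) = _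
      rw [map_mul, rename_monomial, hd, map_add, map_one (rename (⇑e)), rename_X, he0]
    rw [hF] at hren
    exact hren
  fin_cases k
  · exact absurd rfl hk
  · exact key (Equiv.swap 1 2) (by decide) (by simpa using hodd 2 (by decide) (by decide)) (by simpa using hk0)
      (by simpa [Equiv.swap_apply_of_ne_of_ne] using hodd 3 (by decide) (by decide))
  · exact key (Equiv.refl _) rfl (hodd 1 (by decide) (by decide)) hk0 (hodd 3 (by decide) (by decide))
  · exact key (Equiv.swap 2 3) (by decide) (by simpa [Equiv.swap_apply_of_ne_of_ne] using hodd 1 (by decide) (by decide))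
      (by simpa using hk0) (by simpa using hodd 2 (by decide) (by decide))

/-- **CAPSTONE for `a₀ = 1`.** A unit leaf `x^a·(1+x₀)` with `a₀ = 1` is an A-WIN of the plain game over `𝔽₂`, every booking, unless
ALL THREE partner exponents `a₁, a₂, a₃` are odd (0 or 1 odd partner: `stateWins_unitLeaf_of_oddPartners_le_one₀`; 2 odd partners:
`stateWins_unitLeaf_one_twoOdd_even`). [OURS · counted 0 · ‖ K] [folklore] -/
theorem stateWins_unitLeaf_one_of_not_all_odd (a : Fin 4 → ℕ) (h0 : a 0 = 1)
    (hnot : ¬ (a 1 % 2 = 1 ∧ a 2 % 2 = 1 ∧ a 3 % 2 = 1)) (r : Fin 4 →₀ ℕ) (exc : Finset (Fin 4)) :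
    StateWins 2 (⟨monomial (Finsupp.equivFunOnFinite.symm a) 1 * (1 + X 0), r, exc⟩ : State (ZMod 2)) := by
  -- some partner `k` is even
  obtain ⟨k, hk, hk0⟩ : ∃ k : Fin 4, k ≠ 0 ∧ a k % 2 = 0 := by
    by_cases h1 : a 1 % 2 = 1
    · by_cases h2 : a 2 % 2 = 1
      · exact ⟨3, by decide, by omega⟩
      · exact ⟨2, by decide, by omega⟩
    · exact ⟨1, by decide, by omega⟩
  by_cases hodd : ∀ i, i ≠ 0 → i ≠ k → a i % 2 = 1
  · exact stateWins_unitLeaf_one_twoOdd_even k hk a h0 hk0 hodd r exc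
  · -- at most one odd partner
    push Not at hodd
    obtain ⟨i, hi0, hik, hi⟩ := hodd
    refine stateWins_unitLeaf_of_oddPartners_le_one₀ a (fun l hl hl1 l' hl' hl'l => ?_) r exc
    -- `k, i` are even partners, `l` is odd; were `l'` odd too, `k, i, l, l'` would be four distinct non-zero indices
    by_contra hodd'
    have hkv : k.val ≠ 0 := fun h => hk (Fin.ext h)
    have hiv : i.val ≠ 0 := fun h => hi0 (Fin.ext h)
    have hlv : l.val ≠ 0 := fun h => hl (Fin.ext h)
    have hl'v : l'.val ≠ 0 := fun h => hl' (Fin.ext h)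
    have h₁ : i.val ≠ k.val := fun h => hik (Fin.ext h)
    have h₂ : k.val ≠ l.val := fun h => by have hh : k = l := Fin.ext h; rw [hh] at hk0; omega
    have h₃ : k.val ≠ l'.val := fun h => by have hh : k = l' := Fin.ext h; rw [hh] at hk0; omega
    have h₄ : i.val ≠ l.val := fun h => by have hh : i = l := Fin.ext h; rw [hh] at hi; omega
    have h₅ : i.val ≠ l'.val := fun h => by have hh : i = l' := Fin.ext h; rw [hh] at hi; omega
    have h₆ : l'.val ≠ l.val := fun h => hl'l (Fin.ext h)
    have := k.isLt; have := i.isLt; have := l.isLt; have := l'.isLt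
    omega

end PureLeafNF

end Summit.ResolutionOfSingularities.ResolutionOfSingularities.Theorems.PIDim4

end
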